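import Summits.Schanuel.Schanuel.Theorems.RootDecomp1EModuleGridsEdge
import Literature.NumberTheory.Transcendental.BakerLogarithmsConclusion
import HarnessLib


/-!
# RootDecomp1 — lens 1 («grading / quantitative ladder»), gen 19: the CONE LADDER kernel
Record file of node `HOME/decomp-schanuel-lens-1/g19/NODE-g19.md` (route `route-Schanuel-RootDecomp1`, DRAFT;
sibling `route-Schanuel-RootDecomp1E`).  Lens 1 is PARKED on `DefectOneSchanuel` (stmt-Schanuel-30353); this is the
optional kernel of the parked generation, outside the park scope: an EXPLICIT-TUPLE cell on which the open items
* `B`  = `Theses.RootDecomp1E.DefectOneSchanuel` (stmt-Schanuel-25020, text-identical with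
         `Theses.RootDecomp1.DefectOneSchanuel`, the parent of stmt-30353),
* `PlainDefectOne` (stmt-Schanuel-31410, the residual of the sibling route), and
* `S₂` = `Theses.RootDecomp1.SchanuelTwo` (stmt-Schanuel-0069)
are DECIDED (they HOLD) modulo ONE registered Literature statement, while `Schanuel` itself is open there.
THE CELL.  `LogCone(n, 2)` = the ℚ-linearly-independent tuples `z : Fin n → ℂ` of LOGARITHMS OF ALGEBRAIC NUMBERS
(`e^{zᵢ} ∈ ℚ̄`) on a rational quadric cone: `Q(z) = 0`, `Q ∈ ℚ[X₀,…,X_{n-1}]` nonzero homogeneous quadratic (would-be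
members: three logarithms in geometric progression `z₁² = z₀z₂`, isotropic triples `z₀² + z₁² = z₂²`); Schanuel
predicts `LogCone(n, 2) = ∅`, OPEN already for `n = 3` (Waldschmidt, GL 326, Conjecture 1.15 and §12.5).
THE INSTRUMENT.  Roy–Waldschmidt, *Quadratic relations between logarithms of algebraic numbers* (1997), Theorem 0.2 —
the registered named fact `Literature.NumberTheory.Transcendental.royWaldschmidt_quadratic_thm_0_2` (PROVED in the tree
from the two named facts `royWaldschmidt1997_thm_2_1`, `royWaldschmidt1997_thm_4_1` by
`royWaldschmidt_quadratic_thm_0_2_holds_of`, module `…QuadraticRelationsLogarithmsSplit`): a homogeneous `P ∈ ℚ[X]` of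
degree `≤ 2` vanishing at a tuple of logarithms of algebraic numbers either vanishes on a rational subspace containing
the tuple, or `trdeg ℚ(tuple) ≥ 2`.  For a ℚ-FREE tuple the rational subspace is everything, so `P = 0`; hence on the
cone `trdeg ℚ(z) ≥ 2`, and a fortiori `trdeg ℚ(z, e^z) ≥ 2`, i.e. DEFECT `≤ 1` AT `n = 3` — exactly the `n = 3` layer of
`B` / `PlainDefectOne`; and the partner `z₂` of a cone triple is (outside a degenerate sub-case handled by the binary
cone) algebraic over `ℚ(z₀, z₁)`, so `trdeg ℚ(z₀, z₁) ≥ 2`, i.e. `S₂` AT THE PAIR `(z₀, z₁)`.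
BUILD-CONE NOTE.  The modules `Literature.NumberTheory.Transcendental.QuadraticRelationsLogarithms*` are not in the
build cone of this summit's snapshot (`lean check` answers `remote:stale:…:unbuilt`), so the named fact cannot be
imported here: it enters as the EXPLICIT BINDER `h₀₂` of each theorem that uses it (no section variables), the
BODY of `royWaldschmidt_quadratic_thm_0_2`
with its abbreviation `ratSpan s` unfolded to `Submodule.span ℂ ((fun v : Fin n → ℚ => fun i => ((v i : ℚ) : ℂ)) '' s)`
— on a full build `h₀₂ := royWaldschmidt_quadratic_thm_0_2_holds_of h21 h41` up to `Iff.rfl`; the §0 lemmas are copies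
from `…QuadraticRelationsLogarithmsProofs` (same reason).  Baker enters through `bakerFin_holds`, the `n ≤ 2` layer and
the trdeg bookkeeping through lens 2's accepted files.  No `sorry`, no `Prop` definitions, no instances, no notation.
-/

noncomputable section

open Complex IntermediateField

namespace Summit.Schanuel.Schanuel.Theorems.RootDecomp1ConeLadder

open Summit.Schanuel.Schanuel.Theorems.RootDecomp1EAnchor (trdeg_adjoin_le_of_isAlgebraic isAlgebraic_of_mem_adjoin)
open Summit.Schanuel.Schanuel.Theorems.RootDecomp1EModuleGrids (pair01_linearIndependent subMinimal_three)
open Literature.Barriers.Schanuel (trdeg_mono)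
/-! ## §0  Folklore: a rational subspace through a ℚ-free point is everything -/
/-- Rational vectors of the rational span of `s` lie (cast to `ℂⁿ`) in the ℂ-span of the cast image of `s`.
(Copy of `Literature.NumberTheory.Transcendental.cast_mem_ratSpan`, whose module `…QuadraticRelationsLogarithmsProofs`
lies outside this summit's build cone; `ratSpan s` unfolded.) [folklore] -/
theorem cast_mem_span_image {n : ℕ} {s : Set (Fin n → ℚ)} {v : Fin n → ℚ}
    (hv : v ∈ Submodule.span ℚ s) :
    (fun i => ((v i : ℚ) : ℂ)) ∈ Submodule.span ℂ ((fun v : Fin n → ℚ => fun i => ((v i : ℚ) : ℂ)) '' s) := by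
  induction hv using Submodule.span_induction with
  | mem x hx => exact Submodule.subset_span ⟨x, hx, rfl⟩
  | zero =>
    have e : (fun i => (((0 : Fin n → ℚ) i : ℚ) : ℂ)) = 0 := by funext i; simp
    rw [e]; exact (Submodule.span ℂ _).zero_mem
  | add x y _ _ hx hy =>
    have e : (fun i => (((x + y) i : ℚ) : ℂ)) =
        (fun i => ((x i : ℚ) : ℂ)) + fun i => ((y i : ℚ) : ℂ) := by
      funext i; simp
    rw [e]; exact (Submodule.span ℂ _).add_mem hx hy
  | smul c x _ hx =>
    have e : (fun i => (((c • x) i : ℚ) : ℂ)) = (c : ℂ) • fun i => ((x i : ℚ) : ℂ) := by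
      funext i; simp
    rw [e]; exact (Submodule.span ℂ _).smul_mem _ hx

/-- If a subspace of `ℂⁿ` defined over `ℚ` contains a point with ℚ-linearly independent coordinates, the rational
span of its defining vectors is all of `ℚⁿ`: otherwise that span lies in the kernel of a non-zero rational linear
form `∑ aᵢ Xᵢ`, whose complexification vanishes on the subspace, giving the non-trivial relation `∑ aᵢ lᵢ = 0`.
(Copy of `Literature.NumberTheory.Transcendental.span_eq_top_of_mem_ratSpan_of_linearIndependent`, module outside this
build cone.) [folklore] -/
theorem span_eq_top_of_mem_span_image_of_linearIndependent {n : ℕ} {s : Set (Fin n → ℚ)} {l : Fin n → ℂ}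
    (hl : l ∈ Submodule.span ℂ ((fun v : Fin n → ℚ => fun i => ((v i : ℚ) : ℂ)) '' s))
    (hli : LinearIndependent ℚ l) : Submodule.span ℚ s = ⊤ := by
  classical
  by_contra hne
  obtain ⟨f, hf0, hker⟩ :=
    Submodule.exists_le_ker_of_lt_top _ (lt_top_iff_ne_top.mpr hne)
  -- coefficients of `f` in the standard basis
  set a : Fin n → ℚ := fun i => f fun j => if i = j then 1 else 0 with ha
  have hf : ∀ v : Fin n → ℚ, f v = ∑ i, v i * a i := fun v => by
    rw [LinearMap.pi_apply_eq_sum_univ f v]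
    simp [a]
  let F : (Fin n → ℂ) →ₗ[ℂ] ℂ := ∑ i, (a i : ℂ) • LinearMap.proj i
  have hF : ∀ z : Fin n → ℂ, F z = ∑ i, (a i : ℂ) * z i := fun z => by
    simp [F, LinearMap.sum_apply]
  -- `F` vanishes on the subspace
  have hFs : Submodule.span ℂ ((fun v : Fin n → ℚ => fun i => ((v i : ℚ) : ℂ)) '' s) ≤ LinearMap.ker F := by
    refine Submodule.span_le.mpr ?_
    rintro _ ⟨v, hv, rfl⟩
    have hfv : f v = 0 := hker (Submodule.subset_span hv)
    rw [hf] at hfv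
    rw [SetLike.mem_coe, LinearMap.mem_ker, hF]
    have : (((∑ i, v i * a i : ℚ)) : ℂ) = 0 := by rw [hfv]; simp
    simpa [mul_comm] using this
  have hFl : ∑ i, (a i : ℂ) * l i = 0 := by rw [← hF]; exact hFs hl
  have ha0 : ∀ i, a i = 0 := by
    refine Fintype.linearIndependent_iff.mp hli a ?_
    simpa [Rat.smul_def] using hFl
  refine hf0 (LinearMap.ext fun v => ?_)
  rw [hf]
  simp [ha0]

/-- A subspace of `ℂⁿ` defined over `ℚ` through a point with ℚ-linearly independent coordinates is `ℂⁿ`.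
(Copy of `Literature.NumberTheory.Transcendental.ratSpan_eq_top_of_mem_of_linearIndependent`, module outside this
build cone.) [folklore] -/
theorem span_image_eq_top_of_mem_of_linearIndependent {n : ℕ} {s : Set (Fin n → ℚ)} {l : Fin n → ℂ}
    (hl : l ∈ Submodule.span ℂ ((fun v : Fin n → ℚ => fun i => ((v i : ℚ) : ℂ)) '' s))
    (hli : LinearIndependent ℚ l) :
    Submodule.span ℂ ((fun v : Fin n → ℚ => fun i => ((v i : ℚ) : ℂ)) '' s) = ⊤ := by
  classical
  have hspan := span_eq_top_of_mem_span_image_of_linearIndependent hl hli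
  refine eq_top_iff.mpr fun z _ => ?_
  rw [pi_eq_sum_univ z]
  refine Submodule.sum_mem _ fun i _ => Submodule.smul_mem _ _ ?_
  have hmem : (fun j => (((fun k : Fin n => if i = k then (1 : ℚ) else 0) j : ℚ) : ℂ)) ∈
      Submodule.span ℂ ((fun v : Fin n → ℚ => fun i => ((v i : ℚ) : ℂ)) '' s) :=
    cast_mem_span_image (by rw [hspan]; exact Submodule.mem_top)
  convert hmem using 1
  funext j
  by_cases h : i = j <;> simp [h]

/-- A polynomial over `ℚ` vanishing at every rational point of `ℂⁿ` is zero (`ℚ` is infinite: `MvPolynomial.funext`).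
(Copy of `Literature.NumberTheory.Transcendental.eq_zero_of_forall_aeval_cast_eq_zero`, module outside this build
cone.) [folklore] -/
theorem eq_zero_of_forall_aeval_cast_eq_zero {n : ℕ} {Q : MvPolynomial (Fin n) ℚ}
    (h : ∀ w : Fin n → ℚ, MvPolynomial.aeval (fun i => ((w i : ℚ) : ℂ)) Q = 0) : Q = 0 := by
  refine MvPolynomial.funext fun w => ?_
  have hw := h w
  have e : (fun i => ((w i : ℚ) : ℂ)) = algebraMap ℚ ℂ ∘ w := by
    funext i; simp
  rw [e, MvPolynomial.aeval_algebraMap_eq_zero_iff_of_injective (B := ℂ)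
    (algebraMap ℚ ℂ).injective] at hw
  simpa using hw
/-! ## §1  The cone floor: `trdeg ℚ(z) ≥ 2` on `LogCone(n, 2)` (Roy–Waldschmidt 1997, Theorem 0.2) -/
section ConeFloor

/- In this section the explicit binder `h₀₂` of each theorem = the registered named fact
`Literature.NumberTheory.Transcendental.royWaldschmidt_quadratic_thm_0_2` (Roy–Waldschmidt 1997, Theorem 0.2),
body verbatim with `ratSpan s` unfolded — see the BUILD-CONE NOTE. -/

/-- **CONE FLOOR.**  A ℚ-free tuple of logarithms of algebraic numbers lying on a nonzero rational quadric cone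
`Q = 0` generates a field of transcendence degree `≥ 2`: in Theorem 0.2 the first alternative is impossible, because a
rational subspace containing a ℚ-free point is all of `ℂⁿ` (§0) and `Q` would vanish at every rational point. -/
theorem two_le_trdeg_logSpan_of_quadricCone {n : ℕ}
    (h₀₂ : ∀ (n k : ℕ) (P : MvPolynomial (Fin n) ℚ), k ≤ 2 → P.IsHomogeneous k →
      ∀ l : Fin n → ℂ, (∀ i, IsAlgebraic ℚ (cexp (l i))) → MvPolynomial.aeval l P = 0 →
        (∃ s : Set (Fin n → ℚ),
            l ∈ Submodule.span ℂ ((fun v : Fin n → ℚ => fun i => ((v i : ℚ) : ℂ)) '' s) ∧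
            ∀ w ∈ Submodule.span ℂ ((fun v : Fin n → ℚ => fun i => ((v i : ℚ) : ℂ)) '' s),
              MvPolynomial.aeval w P = 0) ∨
        (2 : Cardinal) ≤ Algebra.trdeg ℚ ↥(IntermediateField.adjoin ℚ (Set.range l)))
    (z : Fin n → ℂ) (hz : LinearIndependent ℚ z)
    (halg : ∀ i, IsAlgebraic ℚ (cexp (z i))) (Q : MvPolynomial (Fin n) ℚ) (hQ : Q.IsHomogeneous 2)
    (hQ0 : Q ≠ 0) (hQz : MvPolynomial.aeval z Q = 0) :
    (2 : Cardinal) ≤ Algebra.trdeg ℚ ↥(adjoin ℚ (Set.range z)) := by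
  rcases h₀₂ n 2 Q le_rfl hQ z halg hQz with ⟨s, hs, hV⟩ | h2
  · refine absurd (eq_zero_of_forall_aeval_cast_eq_zero fun w => hV _ ?_) hQ0
    rw [span_image_eq_top_of_mem_of_linearIndependent hs hz]
    exact Submodule.mem_top
  · exact h2

/-- The cone floor read on the member field `K_z = ℚ(z, e^z)` of the items. -/
theorem two_le_trdeg_memberField_of_logQuadricCone {n : ℕ}
    (h₀₂ : ∀ (n k : ℕ) (P : MvPolynomial (Fin n) ℚ), k ≤ 2 → P.IsHomogeneous k →
      ∀ l : Fin n → ℂ, (∀ i, IsAlgebraic ℚ (cexp (l i))) → MvPolynomial.aeval l P = 0 →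
        (∃ s : Set (Fin n → ℚ),
            l ∈ Submodule.span ℂ ((fun v : Fin n → ℚ => fun i => ((v i : ℚ) : ℂ)) '' s) ∧
            ∀ w ∈ Submodule.span ℂ ((fun v : Fin n → ℚ => fun i => ((v i : ℚ) : ℂ)) '' s),
              MvPolynomial.aeval w P = 0) ∨
        (2 : Cardinal) ≤ Algebra.trdeg ℚ ↥(IntermediateField.adjoin ℚ (Set.range l)))
    (z : Fin n → ℂ) (hz : LinearIndependent ℚ z)
    (halg : ∀ i, IsAlgebraic ℚ (cexp (z i))) (Q : MvPolynomial (Fin n) ℚ) (hQ : Q.IsHomogeneous 2)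
    (hQ0 : Q ≠ 0) (hQz : MvPolynomial.aeval z Q = 0) :
    (2 : Cardinal) ≤ Algebra.trdeg ℚ ↥(adjoin ℚ (Set.range z ∪ Set.range (cexp ∘ z))) :=
  (two_le_trdeg_logSpan_of_quadricCone h₀₂ z hz halg Q hQ hQ0 hQz).trans
    (trdeg_mono (adjoin.mono ℚ _ _ Set.subset_union_left))
/-! ## §2  `B` / `PlainDefectOne` decided on the cell `LogCone(3, 2)` -/
/-- **RUNG (B at n = 3 on the cone).**  For every ℚ-free triple `z` of logarithms of algebraic numbers on a nonzero
rational quadric cone, `3 ≤ trdeg ℚ(z, e^z) + 1` — the `n = 3` instance of `DefectOneSchanuel` (stmt-25020 /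
parent of stmt-30353) and of the conclusion of `PlainDefectOne` (stmt-31410) — HOLDS, modulo `h₀₂` alone. -/
theorem defectOne_three_at_logQuadricCone
    (h₀₂ : ∀ (n k : ℕ) (P : MvPolynomial (Fin n) ℚ), k ≤ 2 → P.IsHomogeneous k →
      ∀ l : Fin n → ℂ, (∀ i, IsAlgebraic ℚ (cexp (l i))) → MvPolynomial.aeval l P = 0 →
        (∃ s : Set (Fin n → ℚ),
            l ∈ Submodule.span ℂ ((fun v : Fin n → ℚ => fun i => ((v i : ℚ) : ℂ)) '' s) ∧
            ∀ w ∈ Submodule.span ℂ ((fun v : Fin n → ℚ => fun i => ((v i : ℚ) : ℂ)) '' s),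
              MvPolynomial.aeval w P = 0) ∨
        (2 : Cardinal) ≤ Algebra.trdeg ℚ ↥(IntermediateField.adjoin ℚ (Set.range l)))
    (z : Fin 3 → ℂ) (hz : LinearIndependent ℚ z)
    (halg : ∀ i, IsAlgebraic ℚ (cexp (z i))) (Q : MvPolynomial (Fin 3) ℚ) (hQ : Q.IsHomogeneous 2)
    (hQ0 : Q ≠ 0) (hQz : MvPolynomial.aeval z Q = 0) :
    ((3 : ℕ) : Cardinal) ≤ Algebra.trdeg ℚ ↥(adjoin ℚ (Set.range z ∪ Set.range (cexp ∘ z))) + 1 := by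
  have h2 := two_le_trdeg_memberField_of_logQuadricCone h₀₂ z hz halg Q hQ hQ0 hQz
  have h21 : (2 : Cardinal) + 1 = ((3 : ℕ) : Cardinal) := by norm_num
  rw [← h21]
  exact add_le_add h2 (le_rfl : (1 : Cardinal) ≤ 1)

end ConeFloor

/-- SHAPE PIN (`B`): `Theses.RootDecomp1.DefectOneSchanuel` at a triple = the conclusion of `defectOne_three_…`. -/
theorem defectOneSchanuel_apply_three (hD : Summit.Schanuel.Schanuel.Theses.RootDecomp1.DefectOneSchanuel)
    (z : Fin 3 → ℂ) (hz : LinearIndependent ℚ z) :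
    ((3 : ℕ) : Cardinal) ≤ Algebra.trdeg ℚ ↥(adjoin ℚ (Set.range z ∪ Set.range (cexp ∘ z))) + 1 :=
  hD 3 z hz

/-- SHAPE PIN (`B`, stmt-25020): same for `Theses.RootDecomp1E.DefectOneSchanuel`. -/
theorem defectOneSchanuelE_apply_three (hD : Summit.Schanuel.Schanuel.Theses.RootDecomp1E.DefectOneSchanuel)
    (z : Fin 3 → ℂ) (hz : LinearIndependent ℚ z) :
    ((3 : ℕ) : Cardinal) ≤ Algebra.trdeg ℚ ↥(adjoin ℚ (Set.range z ∪ Set.range (cexp ∘ z))) + 1 :=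
  hD 3 z hz

/-- **PLAINNESS OF LOG TUPLES (Baker).**  A ℚ-free tuple of logarithms of algebraic numbers has no irrational
algebraic multiplier: if `β ∈ ℚ̄` and `β zᵢ₀ ∈ span_ℚ(z)` for one index `i₀`, then `β ∈ ℚ` — by Baker's theorem in
the form `bakerFin_holds` (`1, z₀, …, z_{n-1}` are ℚ̄-linearly independent).  So the cell lies inside the scope
(first hypothesis) of `PlainDefectOne`. -/
theorem ratCast_of_algebraic_multiplier {n : ℕ} (z : Fin n → ℂ) (hz : LinearIndependent ℚ z)
    (halg : ∀ i, IsAlgebraic ℚ (cexp (z i))) (i₀ : Fin n) (β : ℂ) (hβ : IsAlgebraic ℚ β)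
    (hβz : β * z i₀ ∈ Submodule.span ℚ (Set.range z)) : β ∈ Set.range (algebraMap ℚ ℂ) := by
  -- Baker: `z` is linearly independent over `ℚ̄ = algebraicClosure ℚ ℂ`
  have hB : LinearIndependent (algebraicClosure ℚ ℂ) z := by
    have h := Literature.NumberTheory.Transcendental.bakerFin_holds n z halg hz
    exact h.comp some (Option.some_injective _)
  obtain ⟨c, hc⟩ := (Submodule.mem_span_range_iff_exists_fun ℚ).mp hβz
  -- the ℚ̄-relation `∑ⱼ (cⱼ - [j = i₀] β) zⱼ = 0`
  have hβmem : β ∈ algebraicClosure ℚ ℂ := mem_algebraicClosure_iff.mpr hβ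
  let a : Fin n → algebraicClosure ℚ ℂ := fun j =>
    ⟨(c j : ℂ) - if j = i₀ then β else 0, sub_mem (by simp)
      (by split_ifs; exacts [hβmem, zero_mem _])⟩
  have hrel : ∑ j, a j • z j = 0 := by
    have hc' : ∑ j, (c j : ℂ) * z j = β * z i₀ := by simpa [Rat.smul_def] using hc
    simp only [a, IntermediateField.smul_def, smul_eq_mul, sub_mul, Finset.sum_sub_distrib, ite_mul, zero_mul,
      Finset.sum_ite_eq', Finset.mem_univ, if_true, hc', sub_self]
  have ha := Fintype.linearIndependent_iff.mp hB a hrel i₀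
  have hβc : β = (c i₀ : ℂ) := by
    have := congrArg (fun x : algebraicClosure ℚ ℂ => (x : ℂ)) ha
    simp only [a, if_true, ZeroMemClass.coe_zero] at this
    linear_combination -this
  exact ⟨c i₀, by simp [hβc]⟩
/-- Hence a ℚ-free log triple satisfies BOTH hypotheses of `PlainDefectOne` at `n = 3`: it is plain (Baker) and
sub-minimal (the `n ≤ 2` layer is the tree theorem `defectOne_of_le_two`, packaged by lens 2 as `subMinimal_three`). -/
theorem plainDefectOne_hypotheses_of_logTriple (z : Fin 3 → ℂ) (hz : LinearIndependent ℚ z)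
    (halg : ∀ i, IsAlgebraic ℚ (cexp (z i))) :
    (∀ β : ℂ, IsAlgebraic ℚ β → (∀ i, β * z i ∈ Submodule.span ℚ (Set.range z)) →
        β ∈ Set.range (algebraMap ℚ ℂ)) ∧
      (∀ (m : ℕ) (w : Fin m → ℂ), m < 3 → LinearIndependent ℚ w →
        (∀ j, w j ∈ Submodule.span ℚ (Set.range z)) →
        (m : Cardinal) ≤ Algebra.trdeg ℚ ↥(adjoin ℚ (Set.range w ∪ Set.range (cexp ∘ w))) + 1) :=
  ⟨fun β hβ hβz => ratCast_of_algebraic_multiplier z hz halg 0 β hβ (hβz 0), subMinimal_three z⟩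
/-- SHAPE PIN (`PlainDefectOne`, stmt-31410): at a ℚ-free log triple the item's two hypotheses are discharged
(`plainDefectOne_hypotheses_of_logTriple`) and what it then asserts is literally the conclusion of
`defectOne_three_at_logQuadricCone`; so on `LogCone(3, 2)` the item is decided (true) modulo `h₀₂`. -/
theorem plainDefectOne_apply_logTriple (hP : Summit.Schanuel.Schanuel.Theses.RootDecomp1E.PlainDefectOne)
    (z : Fin 3 → ℂ) (hz : LinearIndependent ℚ z) (halg : ∀ i, IsAlgebraic ℚ (cexp (z i))) :
    ((3 : ℕ) : Cardinal) ≤ Algebra.trdeg ℚ ↥(adjoin ℚ (Set.range z ∪ Set.range (cexp ∘ z))) + 1 :=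
  hP 3 z hz (plainDefectOne_hypotheses_of_logTriple z hz halg).1 (plainDefectOne_hypotheses_of_logTriple z hz halg).2
/-! ## §3  `S₂` decided on the pairs of `LogCone(3, 2)` -/
/-- The CONE PARTNER is algebraic over the pair field: if `a z₀² + b z₁² + c z₂² + d z₀z₁ + e z₀z₂ + f z₁z₂ = 0`
with rational coefficients and the equation genuinely involves `z₂` (`¬ (c = 0 ∧ e z₀ + f z₁ = 0)`), then `z₂` is
algebraic over `ℚ(z₀, z₁)`. -/
theorem isAlgebraic_conePartner (z : Fin 3 → ℂ) (a b c d e f : ℚ)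
    (hrel : (a : ℂ) * z 0 ^ 2 + b * z 1 ^ 2 + c * z 2 ^ 2 + d * (z 0 * z 1) + e * (z 0 * z 2) + f * (z 1 * z 2) = 0)
    (hnd : ¬ (c = 0 ∧ (e : ℂ) * z 0 + f * z 1 = 0)) :
    IsAlgebraic ↥(adjoin ℚ (Set.range ![z 0, z 1])) (z 2) := by
  set F : IntermediateField ℚ ℂ := adjoin ℚ (Set.range ![z 0, z 1]) with hF
  have h0F : z 0 ∈ F := subset_adjoin ℚ _ ⟨0, by simp⟩
  have h1F : z 1 ∈ F := subset_adjoin ℚ _ ⟨1, by simp⟩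
  have hqF : ∀ q : ℚ, (q : ℂ) ∈ F := fun q => by simp
  have hBmem : (e : ℂ) * z 0 + f * z 1 ∈ F := add_mem (mul_mem (hqF e) h0F) (mul_mem (hqF f) h1F)
  have hCmem : (a : ℂ) * z 0 ^ 2 + b * z 1 ^ 2 + d * (z 0 * z 1) ∈ F :=
    add_mem (add_mem (mul_mem (hqF a) (pow_mem h0F 2)) (mul_mem (hqF b) (pow_mem h1F 2)))
      (mul_mem (hqF d) (mul_mem h0F h1F))
  -- the quadratic equation of `z₂` over `F`
  let p : Polynomial F := Polynomial.C (⟨(c : ℂ), hqF c⟩ : F) * Polynomial.X ^ 2 +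
      Polynomial.C (⟨_, hBmem⟩ : F) * Polynomial.X + Polynomial.C (⟨_, hCmem⟩ : F)
  refine ⟨p, ?_, ?_⟩
  · intro hp0
    apply hnd
    have h2 := congrArg (fun r : Polynomial F => ((r.coeff 2 : F) : ℂ)) hp0
    have h1 := congrArg (fun r : Polynomial F => ((r.coeff 1 : F) : ℂ)) hp0
    simp only [p, Polynomial.coeff_add, Polynomial.coeff_C_mul, Polynomial.coeff_X_pow, Polynomial.coeff_X,
      Polynomial.coeff_C, Polynomial.coeff_zero] at h1 h2
    norm_num at h1 h2
    exact ⟨by exact_mod_cast h2, h1⟩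
  · simp only [p, map_add, map_mul, Polynomial.aeval_C, Polynomial.aeval_X_pow, Polynomial.aeval_X,
      IntermediateField.algebraMap_apply]
    linear_combination hrel

section ConePairs


/-- **RUNG (S₂ on cone pairs).**  Let `z` be a ℚ-free triple of logarithms of algebraic numbers satisfying a
nonzero rational quadratic relation `a z₀² + b z₁² + c z₂² + d z₀z₁ + e z₀z₂ + f z₁z₂ = 0` (e.g. three logarithms in
geometric progression, `z₁² = z₀z₂`).  Then `SchanuelTwo` HOLDS at the pair `(z₀, z₁)`: `trdeg ℚ(z₀, z₁, e^{z₀},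
e^{z₁}) ≥ 2`, indeed already `trdeg ℚ(z₀, z₁) ≥ 2` — modulo `h₀₂` alone.  (If the relation does not involve `z₂`,
the pair itself lies on the binary cone `a X₀² + d X₀X₁ + b X₁² = 0` and the cone floor applies at `n = 2`;
otherwise `z₂` is algebraic over `ℚ(z₀, z₁)`, which therefore carries the whole floor `trdeg ℚ(z) ≥ 2`.) -/
theorem schanuelTwo_at_logQuadricConePair
    (h₀₂ : ∀ (n k : ℕ) (P : MvPolynomial (Fin n) ℚ), k ≤ 2 → P.IsHomogeneous k →
      ∀ l : Fin n → ℂ, (∀ i, IsAlgebraic ℚ (cexp (l i))) → MvPolynomial.aeval l P = 0 →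
        (∃ s : Set (Fin n → ℚ),
            l ∈ Submodule.span ℂ ((fun v : Fin n → ℚ => fun i => ((v i : ℚ) : ℂ)) '' s) ∧
            ∀ w ∈ Submodule.span ℂ ((fun v : Fin n → ℚ => fun i => ((v i : ℚ) : ℂ)) '' s),
              MvPolynomial.aeval w P = 0) ∨
        (2 : Cardinal) ≤ Algebra.trdeg ℚ ↥(IntermediateField.adjoin ℚ (Set.range l)))
    (z : Fin 3 → ℂ) (hz : LinearIndependent ℚ z)
    (halg : ∀ i, IsAlgebraic ℚ (cexp (z i))) (a b c d e f : ℚ)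
    (h0 : ¬ (a = 0 ∧ b = 0 ∧ c = 0 ∧ d = 0 ∧ e = 0 ∧ f = 0))
    (hrel : (a : ℂ) * z 0 ^ 2 + b * z 1 ^ 2 + c * z 2 ^ 2 + d * (z 0 * z 1) + e * (z 0 * z 2) + f * (z 1 * z 2) = 0) :
    (2 : Cardinal) ≤ Algebra.trdeg ℚ ↥(adjoin ℚ (Set.range ![z 0, z 1] ∪ Set.range (cexp ∘ ![z 0, z 1]))) := by
  have hx : LinearIndependent ℚ ![z 0, z 1] := pair01_linearIndependent z hz
  have hxalg : ∀ i, IsAlgebraic ℚ (cexp ((![z 0, z 1] : Fin 2 → ℂ) i)) := by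
    intro i
    fin_cases i
    · simpa using halg 0
    · simpa using halg 1
  suffices hF : (2 : Cardinal) ≤ Algebra.trdeg ℚ ↥(adjoin ℚ (Set.range ![z 0, z 1])) from
    hF.trans (trdeg_mono (adjoin.mono ℚ _ _ Set.subset_union_left))
  by_cases hnd : c = 0 ∧ (e : ℂ) * z 0 + f * z 1 = 0
  · -- degenerate: the relation is a binary cone through the pair itself
    obtain ⟨hc, hef⟩ := hnd
    have hef' : e = 0 ∧ f = 0 := by
      have h := Fintype.linearIndependent_iff.mp hx ![e, f] (by simpa [Fin.sum_univ_two, Rat.smul_def] using hef)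
      exact ⟨by simpa using h 0, by simpa using h 1⟩
    obtain ⟨he, hf⟩ := hef'
    let Q₂ : MvPolynomial (Fin 2) ℚ := MvPolynomial.C a * (MvPolynomial.X 0 * MvPolynomial.X 0) +
      MvPolynomial.C d * (MvPolynomial.X 0 * MvPolynomial.X 1) + MvPolynomial.C b * (MvPolynomial.X 1 * MvPolynomial.X 1)
    have hm : ∀ (r : ℚ) (i j : Fin 2),
        (MvPolynomial.C r * (MvPolynomial.X i * MvPolynomial.X j) : MvPolynomial (Fin 2) ℚ).IsHomogeneous 2 :=
      fun r i j => ((MvPolynomial.isHomogeneous_X ℚ i).mul (MvPolynomial.isHomogeneous_X ℚ j)).C_mul r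
    have hQ₂h : Q₂.IsHomogeneous 2 := ((hm a 0 0).add (hm d 0 1)).add (hm b 1 1)
    have hQ₂z : MvPolynomial.aeval ![z 0, z 1] Q₂ = 0 := by
      simp only [Q₂, map_add, map_mul, MvPolynomial.aeval_C, MvPolynomial.aeval_X, eq_ratCast,
        Matrix.cons_val_zero, Matrix.cons_val_one]
      subst hc he hf
      push_cast at hrel
      linear_combination hrel
    have hQ₂0 : Q₂ ≠ 0 := by
      intro hQ
      apply h0
      have h10 := congrArg (MvPolynomial.aeval ![(1 : ℂ), 0]) hQ
      have h01 := congrArg (MvPolynomial.aeval ![(0 : ℂ), 1]) hQ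
      have h11 := congrArg (MvPolynomial.aeval ![(1 : ℂ), 1]) hQ
      simp only [Q₂, map_add, map_mul, MvPolynomial.aeval_C, MvPolynomial.aeval_X, eq_ratCast,
        Matrix.cons_val_zero, Matrix.cons_val_one, map_zero, mul_one, mul_zero,
        add_zero, zero_add] at h10 h01 h11
      norm_cast at h10 h01 h11
      refine ⟨h10, h01, hc, ?_, he, hf⟩
      linarith
    exact two_le_trdeg_logSpan_of_quadricCone h₀₂ ![z 0, z 1] hx hxalg Q₂ hQ₂h hQ₂0 hQ₂z
  · -- nondegenerate: `z₂` is algebraic over `F = ℚ(z₀, z₁)`, so `F` carries the whole cone floor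
    let Q : MvPolynomial (Fin 3) ℚ := MvPolynomial.C a * (MvPolynomial.X 0 * MvPolynomial.X 0) +
      MvPolynomial.C b * (MvPolynomial.X 1 * MvPolynomial.X 1) + MvPolynomial.C c * (MvPolynomial.X 2 * MvPolynomial.X 2) +
      MvPolynomial.C d * (MvPolynomial.X 0 * MvPolynomial.X 1) + MvPolynomial.C e * (MvPolynomial.X 0 * MvPolynomial.X 2) +
      MvPolynomial.C f * (MvPolynomial.X 1 * MvPolynomial.X 2)
    have hm : ∀ (r : ℚ) (i j : Fin 3),
        (MvPolynomial.C r * (MvPolynomial.X i * MvPolynomial.X j) : MvPolynomial (Fin 3) ℚ).IsHomogeneous 2 :=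
      fun r i j => ((MvPolynomial.isHomogeneous_X ℚ i).mul (MvPolynomial.isHomogeneous_X ℚ j)).C_mul r
    have hQh : Q.IsHomogeneous 2 :=
      (((((hm a 0 0).add (hm b 1 1)).add (hm c 2 2)).add (hm d 0 1)).add (hm e 0 2)).add (hm f 1 2)
    have hQz : MvPolynomial.aeval z Q = 0 := by
      simp only [Q, map_add, map_mul, MvPolynomial.aeval_C, MvPolynomial.aeval_X, eq_ratCast]
      linear_combination hrel
    have hQ0 : Q ≠ 0 := by
      intro hQ
      apply h0
      have h100 := congrArg (MvPolynomial.aeval ![(1 : ℂ), 0, 0]) hQ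
      have h010 := congrArg (MvPolynomial.aeval ![(0 : ℂ), 1, 0]) hQ
      have h001 := congrArg (MvPolynomial.aeval ![(0 : ℂ), 0, 1]) hQ
      have h110 := congrArg (MvPolynomial.aeval ![(1 : ℂ), 1, 0]) hQ
      have h101 := congrArg (MvPolynomial.aeval ![(1 : ℂ), 0, 1]) hQ
      have h011 := congrArg (MvPolynomial.aeval ![(0 : ℂ), 1, 1]) hQ
      simp only [Q, map_add, map_mul, MvPolynomial.aeval_C, MvPolynomial.aeval_X, eq_ratCast,
        Matrix.cons_val_zero, Matrix.cons_val_one, Matrix.cons_val_two, Matrix.head_cons, Matrix.tail_cons,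
        map_zero, mul_one, mul_zero, add_zero, zero_add] at h100 h010 h001 h110 h101 h011
      norm_cast at h100 h010 h001 h110 h101 h011
      refine ⟨h100, h010, h001, ?_, ?_, ?_⟩ <;> linarith
    have h3 : (2 : Cardinal) ≤ Algebra.trdeg ℚ ↥(adjoin ℚ (Set.range z)) :=
      two_le_trdeg_logSpan_of_quadricCone h₀₂ z hz halg Q hQh hQ0 hQz
    refine h3.trans (trdeg_adjoin_le_of_isAlgebraic ?_)
    rintro _ ⟨i, rfl⟩
    fin_cases i
    · exact isAlgebraic_of_mem_adjoin (subset_adjoin ℚ _ ⟨0, by simp⟩)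
    · exact isAlgebraic_of_mem_adjoin (subset_adjoin ℚ _ ⟨1, by simp⟩)
    · exact isAlgebraic_conePartner z a b c d e f hrel hnd

end ConePairs
/-- SHAPE PIN (`S₂`, stmt-0069): `Theses.RootDecomp1.SchanuelTwo` at `(z₀, z₁)` = the conclusion of the previous theorem. -/
theorem schanuelTwo_apply_pair01 (h₂ : Summit.Schanuel.Schanuel.Theses.RootDecomp1.SchanuelTwo) (z : Fin 3 → ℂ)
    (hz : LinearIndependent ℚ z) :
    (2 : Cardinal) ≤ Algebra.trdeg ℚ ↥(adjoin ℚ (Set.range ![z 0, z 1] ∪ Set.range (cexp ∘ ![z 0, z 1]))) :=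
  h₂ ![z 0, z 1] (pair01_linearIndependent z hz)

end Summit.Schanuel.Schanuel.Theorems.RootDecomp1ConeLadder

end
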